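import Literature.NumberTheory.DiophantineGeometry.GenEllThm21With
import HarnessLib

/-!
# [GenEll] Ex. 1.3 (ii) / Thm. 2.1 for `ℚ`-points: WHICH abc triples are `ρ`-far from the cusps — the
# far-from-cusps families of the exponent programme, in elementary terms

S. Mochizuki, *Arithmetic elliptic curves in general position*, Math. J. Okayama Univ. 52 (2010)
[cite: MochizukiGenEll2010, Ex 1.3 (ii) p.5; Thm 2.1 p.12]. PROOF-ONLY file (0 definitions). The R-H
round-2 exponent programme (abc-iut cell, EXP-SPEC, ruling R19) concludes «abc with exponent `Λ` ON the
family of triples whose point `λ = a/c` is `ρ`-far from the cusps at `∞` and at the primes of `S`»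
(`GenEll.abcExpOn_farFromCusps_of_abcCompactlyBoundedWith`, `GenEllThm21With.lean` §4: the annulus
compactly bounded subset, no Belyi transfer). This file says, as kernel iffs, which triples those are:

* `farFromCusps_ratPoint_iff` — for a `ℚ`-point `λ = q`: `ρ < |q| < ρ⁻¹`, `ρ < |q − 1|` (the one complex
  conjugate) and `ρ ≤ |q|_p ≤ ρ⁻¹`, `ρ ≤ |q − 1|_p` for `p ∈ S` (the one `Q̄_p`-conjugate, Mathlib's
  `padicNorm`);
* `farFromCusps_ratPoint_triple_iff` — for an abc triple `(a, b, c)` (`a + b = c`, coprime) and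
  `0 < ρ ≤ 1`: `λ = a/c` is `ρ`-far from the cusps at `∞` and at the primes of `S` IFF
  `ρ·c < a ∧ ρ·c < b` (archimedean: `|λ| = a/c`, `|λ − 1| = b/c`) AND `ρ ≤ |a|_p ∧ ρ ≤ |b|_p ∧ ρ ≤ |c|_p`
  for every `p ∈ S` (i.e. `p^{v_p(a)}, p^{v_p(b)}, p^{v_p(c)} ≤ ρ⁻¹`; at most one of them exceeds `1` by
  coprimality, so this is `p^{v_p(abc)} ≤ ρ⁻¹`);
* `abcExp_triple_of_abcCompactlyBoundedWith` — the programme's far-from-cusps sentence in these words: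
  (ii)_Λ at `S` ⟹ for every `0 < ρ ≤ 1/2`, `∀ ε > 0, ∃ C > 0`, `c < C·rad(abc)^{Λ(1+ε)}` for all abc triples
  with `ρ·c < min(a, b)` and `ρ ≤ |a|_p, |b|_p, |c|_p` (`p ∈ S`).

Elementary; classical; (ii)_Λ is a hypothesis asserted by nobody; nothing here asserts abc proved or
refuted or bears on [IUTchIII] Cor. 3.12.
-/

noncomputable section

open NumberField

namespace Literature.NumberTheory.DiophantineGeometry.GenEll

/-- The complex conjugates of a `ℚ`-point are the one value `(q : ℂ)`. [folklore] -/
private theorem forall_ratHom_complex_iff (q : ℚ) (Φ : ℂ → Prop) :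
    (∀ σ : ℚ →+* ℂ, Φ (σ q)) ↔ Φ (q : ℂ) :=
  ⟨fun h => by simpa using h (Rat.castHom ℂ), fun h σ => by rwa [eq_ratCast]⟩

/-- The `Q̄_p`-conjugates of a `ℚ`-point are the one value `(q : Q̄_p)`. [folklore] -/
private theorem forall_ratHom_padic_iff (p : ℕ) [Fact p.Prime] (q : ℚ) (Φ : PadicAlgCl p → Prop) :
    (∀ σ : ℚ →+* PadicAlgCl p, Φ (σ q)) ↔ Φ (q : PadicAlgCl p) :=
  ⟨fun h => by simpa using h (Rat.castHom (PadicAlgCl p)), fun h σ => by rwa [eq_ratCast]⟩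

/-- `‖(q : Q̄_p)‖ = |q|_p` (Mathlib's `padicNorm`, cast to `ℝ`). [folklore] -/
private theorem norm_ratCast_padicAlgCl (p : ℕ) [Fact p.Prime] (q : ℚ) :
    ‖(q : PadicAlgCl p)‖ = ((padicNorm p q : ℚ) : ℝ) := by
  rw [← map_ratCast (algebraMap ℚ_[p] (PadicAlgCl p)) q]
  exact (PadicAlgCl.norm_extends p (q : ℚ_[p])).trans (Padic.eq_padicNorm q)

/-- **A `ℚ`-point `λ = q` is `ρ`-far from the cusps at `∞` and at the primes of `S`** iff `ρ < |q| < ρ⁻¹`,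
`ρ < |q − 1|`, and `ρ ≤ |q|_p ≤ ρ⁻¹`, `ρ ≤ |q − 1|_p` for every `p ∈ S` — the definition
`NFPoint.FarFromCusps` read at the single complex and the single `Q̄_p`-conjugate of a rational point.
[cite: MochizukiGenEll2010, Ex 1.3 (ii) p.5] -/
theorem farFromCusps_ratPoint_iff (S : Finset ℕ) (ρ : ℝ) (q : ℚ) :
    (ratPoint q).FarFromCusps S ρ ↔
      (ρ < |(q : ℝ)| ∧ |(q : ℝ)| < ρ⁻¹ ∧ ρ < |(q : ℝ) - 1|) ∧
        ∀ p ∈ S, ∀ [Fact p.Prime],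
          ρ ≤ ((padicNorm p q : ℚ) : ℝ) ∧ ((padicNorm p q : ℚ) : ℝ) ≤ ρ⁻¹ ∧
            ρ ≤ ((padicNorm p (q - 1) : ℚ) : ℝ) := by
  unfold NFPoint.FarFromCusps
  change ((∀ σ : ℚ →+* ℂ, ρ < ‖σ q‖ ∧ ‖σ q‖ < ρ⁻¹ ∧ ρ < ‖σ q - 1‖) ∧
      ∀ p ∈ S, ∀ [Fact p.Prime], ∀ σ : ℚ →+* PadicAlgCl p,
        ρ ≤ ‖σ q‖ ∧ ‖σ q‖ ≤ ρ⁻¹ ∧ ρ ≤ ‖σ q - 1‖) ↔ _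
  refine and_congr ?_ (forall_congr' fun p => forall_congr' fun _ => forall_congr' fun _ => ?_)
  · rw [forall_ratHom_complex_iff q (fun z => ρ < ‖z‖ ∧ ‖z‖ < ρ⁻¹ ∧ ρ < ‖z - 1‖)]
    have h1 : ‖(q : ℂ) - 1‖ = |(q : ℝ) - 1| := by
      rw [show (q : ℂ) - 1 = ((q - 1 : ℚ) : ℂ) by push_cast; ring, Complex.norm_ratCast]; push_cast; ring_nf
    rw [Complex.norm_ratCast, h1]
  · rw [forall_ratHom_padic_iff p q (fun z => ρ ≤ ‖z‖ ∧ ‖z‖ ≤ ρ⁻¹ ∧ ρ ≤ ‖z - 1‖)]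
    have h1 : ‖(q : PadicAlgCl p) - 1‖ = ((padicNorm p (q - 1) : ℚ) : ℝ) := by
      rw [show (q : PadicAlgCl p) - 1 = ((q - 1 : ℚ) : PadicAlgCl p) by push_cast; ring,
        norm_ratCast_padicAlgCl]
    rw [norm_ratCast_padicAlgCl, h1]

/-- For an abc triple, `c = a + b > 0`. [folklore] -/
private theorem pos_c' {a b c : ℕ} (h : IsABCTriple a b c) : 0 < c := by
  obtain ⟨ha, -, habc, -⟩ := h; omega

/-- For an abc triple and a prime `p`: NOT both `p ∣ a` and `p ∣ c`, NOT both `p ∣ b` and `p ∣ c`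
(`gcd(a, b) = 1`, `c = a + b`). [folklore] -/
private theorem not_dvd_two {a b c : ℕ} (h : IsABCTriple a b c) {p : ℕ} (hp : p.Prime) :
    ¬ (p ∣ a ∧ p ∣ c) ∧ ¬ (p ∣ b ∧ p ∣ c) := by
  obtain ⟨-, -, habc, hcop⟩ := h
  refine ⟨fun ⟨hpa, hpc⟩ => ?_, fun ⟨hpb, hpc⟩ => ?_⟩
  · have hpb : p ∣ b := by
      have : p ∣ a + b := habc ▸ hpc
      exact (Nat.dvd_add_right hpa).1 this
    have h1 : p ∣ Nat.gcd a b := Nat.dvd_gcd hpa hpb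
    rw [hcop.gcd_eq_one] at h1
    exact hp.one_lt.ne' (Nat.dvd_one.1 h1)
  · have hpa : p ∣ a := by
      have : p ∣ a + b := habc ▸ hpc
      exact (Nat.dvd_add_left hpb).1 this
    have h1 : p ∣ Nat.gcd a b := Nat.dvd_gcd hpa hpb
    rw [hcop.gcd_eq_one] at h1
    exact hp.one_lt.ne' (Nat.dvd_one.1 h1)

/-- **WHICH abc TRIPLES ARE `ρ`-FAR FROM THE CUSPS.** For an abc triple `(a, b, c)` and `0 < ρ ≤ 1`, the
point `λ = a/c ∈ U_P(ℚ)` is `ρ`-far from the cusps at `∞` and at the primes of `S` IFF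
`ρ·c < a ∧ ρ·c < b` (at `∞`: `|λ| = a/c`, `|λ − 1| = b/c`, and `a/c < 1 ≤ ρ⁻¹` automatically) AND, for every
prime `p ∈ S`, `ρ ≤ |a|_p ∧ ρ ≤ |b|_p ∧ ρ ≤ |c|_p` (i.e. each of `p^{v_p(a)}, p^{v_p(b)}, p^{v_p(c)}` is
`≤ ρ⁻¹`; since `a, b, c` are pairwise coprime at most one differs from `1`, so this is `p^{v_p(abc)} ≤ ρ⁻¹` —
at `S = {2}`: `2^{v₂(abc)} ≤ ρ⁻¹`, one of `a, b, c` being even). [cite: MochizukiGenEll2010, Ex 1.3 (ii) p.5] -/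
theorem farFromCusps_ratPoint_triple_iff {a b c : ℕ} (h : IsABCTriple a b c) {S : Finset ℕ}
    (hS : ∀ p ∈ S, p.Prime) {ρ : ℝ} (h0 : 0 < ρ) (h1 : ρ ≤ 1) :
    (ratPoint ((a : ℚ) / c)).FarFromCusps S ρ ↔
      (ρ * c < a ∧ ρ * c < b) ∧
        ∀ p ∈ S, ρ ≤ ((padicNorm p a : ℚ) : ℝ) ∧ ρ ≤ ((padicNorm p b : ℚ) : ℝ) ∧
          ρ ≤ ((padicNorm p c : ℚ) : ℝ) := by
  have hc : 0 < c := pos_c' h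
  have hcR : (0 : ℝ) < c := by exact_mod_cast hc
  have hcQ : (c : ℚ) ≠ 0 := by exact_mod_cast hc.ne'
  have habc : (a : ℝ) + b = c := by exact_mod_cast h.2.2.1
  have hρinv : 1 ≤ ρ⁻¹ := one_le_inv_iff₀.2 ⟨h0, h1⟩
  rw [farFromCusps_ratPoint_iff]
  refine and_congr ?_ (forall_congr' fun p => ?_)
  · -- archimedean part
    have hq : (((a : ℚ) / c : ℚ) : ℝ) = (a : ℝ) / c := by push_cast; ring
    rw [hq]
    have ha0 : (0 : ℝ) ≤ (a : ℝ) / c := by positivity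
    have hsub : (a : ℝ) / c - 1 = -((b : ℝ) / c) := by field_simp; linarith
    rw [abs_of_nonneg ha0, hsub, abs_neg, abs_of_nonneg (by positivity : (0 : ℝ) ≤ (b : ℝ) / c),
      lt_div_iff₀ hcR, lt_div_iff₀ hcR, div_lt_iff₀ hcR]
    constructor
    · rintro ⟨h1', -, h3⟩; exact ⟨h1', h3⟩
    · rintro ⟨h1', h3⟩
      refine ⟨h1', ?_, h3⟩
      have hac : (a : ℝ) < c := by
        have hb : (0 : ℝ) < b := by have := h.2.1; exact_mod_cast this
        linarith
      calc (a : ℝ) < c := hac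
        _ ≤ ρ⁻¹ * c := le_mul_of_one_le_left hcR.le hρinv
  · -- `p`-adic part
    constructor
    · intro hP hp
      haveI : Fact p.Prime := ⟨hS p hp⟩
      obtain ⟨hx1, hx2, hx3⟩ := hP hp
      have hdiv : padicNorm p ((a : ℚ) / c) = padicNorm p a / padicNorm p c := padicNorm.div _ _
      have hsub : padicNorm p ((a : ℚ) / c - 1) = padicNorm p b / padicNorm p c := by
        rw [show (a : ℚ) / c - 1 = -((b : ℚ) / c) by field_simp; have := h.2.2.1; push_cast [← this]; ring,
          padicNorm.neg, padicNorm.div]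
      rw [hdiv] at hx1 hx2
      rw [hsub] at hx3
      have hua : padicNorm p a ≤ 1 := padicNorm.of_nat _
      have hub : padicNorm p b ≤ 1 := padicNorm.of_nat _
      have huc : padicNorm p c ≤ 1 := padicNorm.of_nat _
      have hpc : 0 < padicNorm p c :=
        lt_of_le_of_ne (padicNorm.nonneg _) (padicNorm.nonzero hcQ).symm
      have hpcR : (0 : ℝ) < ((padicNorm p c : ℚ) : ℝ) := by exact_mod_cast hpc
      -- at most one of `|a|_p, |c|_p` (resp. `|b|_p, |c|_p`) is `< 1`
      obtain ⟨hnac, hnbc⟩ := not_dvd_two h (hS p hp)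
      push_cast at hx1 hx2 hx3
      rw [le_div_iff₀ hpcR] at hx1 hx3
      rw [div_le_iff₀ hpcR] at hx2
      by_cases hcc : padicNorm p c = 1
      · have hccR : ((padicNorm p c : ℚ) : ℝ) = 1 := by exact_mod_cast hcc
        rw [hccR] at hx1 hx3
        refine ⟨by linarith, by linarith, by rw [hccR]; exact h1⟩
      · -- `p ∣ c`, hence `p ∤ a`, `p ∤ b`: `|a|_p = |b|_p = 1`
        have hpc' : p ∣ c := by
          by_contra hnd; exact hcc ((padicNorm.nat_eq_one_iff c).2 hnd)
        have haa : padicNorm p a = 1 := (padicNorm.nat_eq_one_iff a).2 fun hpa => hnac ⟨hpa, hpc'⟩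
        have hbb : padicNorm p b = 1 := (padicNorm.nat_eq_one_iff b).2 fun hpb => hnbc ⟨hpb, hpc'⟩
        have haaR : ((padicNorm p a : ℚ) : ℝ) = 1 := by exact_mod_cast haa
        have hbbR : ((padicNorm p b : ℚ) : ℝ) = 1 := by exact_mod_cast hbb
        rw [haaR] at hx2
        refine ⟨by rw [haaR]; exact h1, by rw [hbbR]; exact h1, ?_⟩
        -- `1 ≤ ρ⁻¹ · |c|_p` ⟹ `ρ ≤ |c|_p`
        have := mul_le_mul_of_nonneg_left hx2 h0.le
        rw [← mul_assoc, mul_inv_cancel₀ h0.ne', one_mul, mul_one] at this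
        exact this
    · intro hP hp _
      obtain ⟨hxa, hxb, hxc⟩ := hP hp
      have hdiv : padicNorm p ((a : ℚ) / c) = padicNorm p a / padicNorm p c := padicNorm.div _ _
      have hsub : padicNorm p ((a : ℚ) / c - 1) = padicNorm p b / padicNorm p c := by
        rw [show (a : ℚ) / c - 1 = -((b : ℚ) / c) by field_simp; have := h.2.2.1; push_cast [← this]; ring,
          padicNorm.neg, padicNorm.div]
      rw [hdiv, hsub]
      have hua : padicNorm p a ≤ 1 := padicNorm.of_nat _
      have hub : padicNorm p b ≤ 1 := padicNorm.of_nat _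
      have huc : padicNorm p c ≤ 1 := padicNorm.of_nat _
      have hpcR : (0 : ℝ) < ((padicNorm p c : ℚ) : ℝ) := lt_of_lt_of_le h0 hxc
      have huaR : ((padicNorm p a : ℚ) : ℝ) ≤ 1 := by exact_mod_cast hua
      have hubR : ((padicNorm p b : ℚ) : ℝ) ≤ 1 := by exact_mod_cast hub
      have hucR : ((padicNorm p c : ℚ) : ℝ) ≤ 1 := by exact_mod_cast huc
      obtain ⟨hnac, hnbc⟩ := not_dvd_two h (hS p hp)
      push_cast
      rw [le_div_iff₀ hpcR, le_div_iff₀ hpcR, div_le_iff₀ hpcR]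
      by_cases hcc : padicNorm p c = 1
      · have hccR : ((padicNorm p c : ℚ) : ℝ) = 1 := by exact_mod_cast hcc
        rw [hccR]
        refine ⟨by linarith, ?_, by linarith⟩
        calc ((padicNorm p a : ℚ) : ℝ) ≤ 1 := huaR
          _ ≤ ρ⁻¹ * 1 := by rw [mul_one]; exact hρinv
      · have hpc' : p ∣ c := by
          by_contra hnd; exact hcc ((padicNorm.nat_eq_one_iff c).2 hnd)
        have haa : padicNorm p a = 1 := (padicNorm.nat_eq_one_iff a).2 fun hpa => hnac ⟨hpa, hpc'⟩
        have hbb : padicNorm p b = 1 := (padicNorm.nat_eq_one_iff b).2 fun hpb => hnbc ⟨hpb, hpc'⟩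
        have haaR : ((padicNorm p a : ℚ) : ℝ) = 1 := by exact_mod_cast haa
        have hbbR : ((padicNorm p b : ℚ) : ℝ) = 1 := by exact_mod_cast hbb
        rw [haaR, hbbR]
        refine ⟨by nlinarith, ?_, by nlinarith⟩
        -- `ρ ≤ |c|_p` ⟹ `1 ≤ ρ⁻¹ · |c|_p`
        have := mul_le_mul_of_nonneg_left hxc (inv_pos.2 h0).le
        rwa [inv_mul_cancel₀ h0.ne'] at this

/-- **THE FAR-FROM-CUSPS SENTENCE OF THE EXPONENT PROGRAMME, IN ELEMENTARY WORDS.** If (ii)_Λ holds at the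
finite set of primes `S`, then for every `0 < ρ ≤ 1/2` and every `ε > 0` there is `C = C(ρ, ε) > 0` with
`c < C·rad(abc)^{Λ(1+ε)}` for ALL abc triples `(a, b, c)` such that `ρ·c < a`, `ρ·c < b` and
`ρ ≤ |a|_p, |b|_p, |c|_p` for every `p ∈ S` (`S = {2}`: `min(a, b) > ρ·c` and `2^{v₂(abc)} ≤ ρ⁻¹`). No Belyi
transfer; (ii)_Λ is a HYPOTHESIS. PROVED. [cite: MochizukiGenEll2010, Thm 2.1 p.12] -/
theorem abcExp_triple_of_abcCompactlyBoundedWith {S : Finset ℕ} (hS : ∀ p ∈ S, p.Prime) {Λ : ℝ}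
    (h : ABCCompactlyBoundedWith S Λ) {ρ : ℝ} (h0 : 0 < ρ) (h2 : ρ ≤ 1 / 2) {ε : ℝ} (hε : 0 < ε) :
    ∃ C : ℝ, 0 < C ∧ ∀ a b c : ℕ, IsABCTriple a b c → (ρ * c < a ∧ ρ * c < b) →
      (∀ p ∈ S, ρ ≤ ((padicNorm p a : ℚ) : ℝ) ∧ ρ ≤ ((padicNorm p b : ℚ) : ℝ) ∧
        ρ ≤ ((padicNorm p c : ℚ) : ℝ)) →
      (c : ℝ) < C * ((rad a b c : ℕ) : ℝ) ^ (Λ * (1 + ε)) := by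
  obtain ⟨C, hC, hK⟩ := abcExpOn_farFromCusps_of_abcCompactlyBoundedWith hS h h0 h2 ε hε
  refine ⟨C, hC, fun a b c ht harc hnon => hK a b c ht ?_⟩
  exact (farFromCusps_ratPoint_triple_iff ht hS h0 (h2.trans (by norm_num))).2 ⟨harc, hnon⟩


/-! ## (APPENDED 2026-08-27, typer) Every abc triple lies in SOME far-from-cusps family — the exponent gap
between the programme's conclusion and `ABCWithExponent Λ` is exactly UNIFORMITY of the constant in `ρ` -/

/-- **Every abc triple is `ρ`-far from the cusps for SOME `0 < ρ ≤ 1/2`** (depending on the triple): take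
`ρ := ½·(min(a,b)/c)·Π_{p ∈ S} |a|_p·|b|_p·|c|_p`. So the far-from-cusps families EXHAUST the abc triples as
`ρ → 0`; what (ii)_Λ does not give (R19) is a constant `C` uniform in `ρ`. [cite: MochizukiGenEll2010, Ex 1.3 (ii) p.5] -/
theorem exists_farFromCusps_ratPoint_triple {a b c : ℕ} (h : IsABCTriple a b c) {S : Finset ℕ}
    (hS : ∀ p ∈ S, p.Prime) :
    ∃ ρ : ℝ, 0 < ρ ∧ ρ ≤ 1 / 2 ∧ (ratPoint ((a : ℚ) / c)).FarFromCusps S ρ := by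
  have ha : 0 < a := h.1
  have hb : 0 < b := h.2.1
  have hc : 0 < c := pos_c' h
  have habc : a + b = c := h.2.2.1
  -- the `p`-adic factor `N = Π_{p ∈ S} |a|_p |b|_p |c|_p ∈ (0, 1]`
  let f : ℕ → ℝ := fun p =>
    ((padicNorm p a : ℚ) : ℝ) * ((padicNorm p b : ℚ) : ℝ) * ((padicNorm p c : ℚ) : ℝ)
  have key : ∀ p ∈ S, 0 < f p ∧ f p ≤ 1 ∧ f p ≤ ((padicNorm p a : ℚ) : ℝ) ∧
      f p ≤ ((padicNorm p b : ℚ) : ℝ) ∧ f p ≤ ((padicNorm p c : ℚ) : ℝ) := fun p hp => by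
    haveI : Fact p.Prime := ⟨hS p hp⟩
    have h1 : ∀ n : ℕ, ((padicNorm p n : ℚ) : ℝ) ≤ 1 := fun n => by exact_mod_cast padicNorm.of_nat n
    have h0 : ∀ {n : ℕ}, 0 < n → 0 < ((padicNorm p n : ℚ) : ℝ) := fun {n} hn => by
      have hq : (n : ℚ) ≠ 0 := by exact_mod_cast hn.ne'
      exact_mod_cast lt_of_le_of_ne (padicNorm.nonneg _) (padicNorm.nonzero hq).symm
    have hx0 := h0 ha; have hy0 := h0 hb; have hz0 := h0 hc
    have hx1 := h1 a; have hy1 := h1 b; have hz1 := h1 c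
    change 0 < ((padicNorm p a : ℚ) : ℝ) * ((padicNorm p b : ℚ) : ℝ) * ((padicNorm p c : ℚ) : ℝ) ∧
      ((padicNorm p a : ℚ) : ℝ) * ((padicNorm p b : ℚ) : ℝ) * ((padicNorm p c : ℚ) : ℝ) ≤ 1 ∧
      ((padicNorm p a : ℚ) : ℝ) * ((padicNorm p b : ℚ) : ℝ) * ((padicNorm p c : ℚ) : ℝ) ≤ _ ∧
      ((padicNorm p a : ℚ) : ℝ) * ((padicNorm p b : ℚ) : ℝ) * ((padicNorm p c : ℚ) : ℝ) ≤ _ ∧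
      ((padicNorm p a : ℚ) : ℝ) * ((padicNorm p b : ℚ) : ℝ) * ((padicNorm p c : ℚ) : ℝ) ≤ _
    refine ⟨mul_pos (mul_pos hx0 hy0) hz0, ?_, ?_, ?_, ?_⟩
    · exact mul_le_one₀ (mul_le_one₀ hx1 hy0.le hy1) hz0.le hz1
    · rw [mul_assoc]; exact mul_le_of_le_one_right hx0.le (mul_le_one₀ hy1 hz0.le hz1)
    · rw [show ((padicNorm p a : ℚ) : ℝ) * ((padicNorm p b : ℚ) : ℝ) * ((padicNorm p c : ℚ) : ℝ) =
          ((padicNorm p b : ℚ) : ℝ) * (((padicNorm p a : ℚ) : ℝ) * ((padicNorm p c : ℚ) : ℝ)) by ring]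
      exact mul_le_of_le_one_right hy0.le (mul_le_one₀ hx1 hz0.le hz1)
    · rw [show ((padicNorm p a : ℚ) : ℝ) * ((padicNorm p b : ℚ) : ℝ) * ((padicNorm p c : ℚ) : ℝ) =
          ((padicNorm p c : ℚ) : ℝ) * (((padicNorm p a : ℚ) : ℝ) * ((padicNorm p b : ℚ) : ℝ)) by ring]
      exact mul_le_of_le_one_right hz0.le (mul_le_one₀ hx1 hy0.le hy1)
  set N : ℝ := ∏ p ∈ S, f p with hN
  have hN0 : 0 < N := Finset.prod_pos fun p hp => (key p hp).1
  have hN1 : N ≤ 1 := Finset.prod_le_one (fun p hp => (key p hp).1.le) fun p hp => (key p hp).2.1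
  have hNle : ∀ p ∈ S, N ≤ f p := fun p hp => by
    rw [hN, ← Finset.mul_prod_erase S f hp]
    calc f p * ∏ q ∈ S.erase p, f q ≤ f p * 1 :=
          mul_le_mul_of_nonneg_left
            (Finset.prod_le_one (fun q hq => (key q (Finset.mem_of_mem_erase hq)).1.le)
              fun q hq => (key q (Finset.mem_of_mem_erase hq)).2.1) (key p hp).1.le
      _ = f p := mul_one _
  -- the archimedean factor `min(a,b)/c ∈ (0, 1]`
  set m : ℕ := min a b with hm
  have hm0 : 0 < m := lt_min ha hb
  have hmR : (0 : ℝ) < m := by exact_mod_cast hm0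
  have hcR : (0 : ℝ) < c := by exact_mod_cast hc
  have hma : (m : ℝ) ≤ a := by exact_mod_cast min_le_left a b
  have hmb : (m : ℝ) ≤ b := by exact_mod_cast min_le_right a b
  have hmc : (m : ℝ) / c ≤ 1 := by
    rw [div_le_one hcR]
    have : (a : ℝ) ≤ c := by exact_mod_cast (show a ≤ c by omega)
    linarith
  have hmc0 : 0 < (m : ℝ) / c := div_pos hmR hcR
  refine ⟨1 / 2 * ((m : ℝ) / c) * N, by positivity, ?_, ?_⟩
  · calc 1 / 2 * ((m : ℝ) / c) * N ≤ 1 / 2 * 1 * 1 := by gcongr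
      _ = 1 / 2 := by ring
  · have hρ1 : 1 / 2 * ((m : ℝ) / c) * N ≤ 1 := by
      calc 1 / 2 * ((m : ℝ) / c) * N ≤ 1 / 2 * 1 * 1 := by gcongr
        _ ≤ 1 := by norm_num
    refine (farFromCusps_ratPoint_triple_iff h hS (by positivity) hρ1).2 ⟨⟨?_, ?_⟩, fun p hp => ?_⟩
    · -- `ρ·c = ½·m·N < m ≤ a`
      have : 1 / 2 * ((m : ℝ) / c) * N * c = 1 / 2 * m * N := by field_simp
      rw [this]; nlinarith
    · have : 1 / 2 * ((m : ℝ) / c) * N * c = 1 / 2 * m * N := by field_simp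
      rw [this]; nlinarith
    · have hρN : 1 / 2 * ((m : ℝ) / c) * N ≤ N := by
        calc 1 / 2 * ((m : ℝ) / c) * N ≤ 1 / 2 * 1 * N := by gcongr
          _ ≤ N := by linarith
      obtain ⟨-, -, hfa, hfb, hfc⟩ := key p hp
      have hfp := hNle p hp
      exact ⟨by linarith, by linarith, by linarith⟩

/-- **The exponent gap is uniformity in `ρ`.** abc with exponent `Λ` (all triples) is EQUIVALENT to abc with
exponent `Λ` on the UNION over `ρ > 0` of the far-from-cusps families (every triple lies in one of them,
`exists_farFromCusps_ratPoint_triple`); the exponent programme (R19) delivers it on EACH family with a constant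
`C(ρ, ε)` — the whole remaining content of «(ii)_Λ ⇒ abc with exponent Λ» is ONE constant serving every `ρ`,
which is what print's Belyi transfer supplies at `Λ = 1` and does not at `Λ > 1`. [cite: MochizukiGenEll2010, Thm 2.1 p.12] -/
theorem abcWithExponent_iff_abcWithExponentOn_exists_far (S : Finset ℕ) (hS : ∀ p ∈ S, p.Prime) (Λ : ℝ) :
    ABCWithExponent Λ ↔ ABCWithExponentOn {P : NFPoint | ∃ ρ : ℝ, 0 < ρ ∧ P.FarFromCusps S ρ} Λ := by
  rw [← abcWithExponentOn_univ_iff]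
  refine ⟨fun h => h.mono (Set.subset_univ _), fun h ε hε => ?_⟩
  obtain ⟨C, hC, hK⟩ := h ε hε
  refine ⟨C, hC, fun a b c ht _ => hK a b c ht ?_⟩
  obtain ⟨ρ, h0, -, hfar⟩ := exists_farFromCusps_ratPoint_triple ht hS
  exact ⟨ρ, h0, hfar⟩

end Literature.NumberTheory.DiophantineGeometry.GenEll

end
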